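import Literature.Probability.RandomPlanarGeometry.SupercriticalSAWPolygons
import HarnessLib

/-!
# Tiles with margins, inner boxes, ports and connectors (geometry for the polygon-insertion
# surgery of Duminil-Copin–Kozma–Yadin 2014, Theorem 6)

H. Duminil-Copin, G. Kozma, A. Yadin, *Supercritical self-avoiding walks are space-filling*,
Ann. IHP Probab. Stat. 50 (2014), §3, tile `ℤ²` by boxes of side `2m+1` and insert a polygon of
`P_m` (`Literature.Probability.RandomPlanarGeometry.SAW.facePolygons m`) in each box of a
connected family, merging adjacent polygons through their facing cardinal edges. For a
sorry-free proof we keep a MARGIN of width `r` (resp. `r+1`) around each polygon box: the tiles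
are the `ℓ^∞`-balls `tile m r τ = B_∞(L τ, h)` of radius `h = m + r + 1` (odd side
`L = 2h + 1`, centre `ctr m r τ = L τ`), the polygon of tile `τ` lives in the inner box
`innerBox m r τ = (L τ - (m+1, m+1)) + [0, 2m+1]²`, whose four cardinal edges
(`portA/portB m r τ d`, `d : Dir`) face the four neighbouring tiles, and facing cardinal edges
of adjacent tiles are joined by the two straight CONNECTORS `connA/connB` of `2r + 2` steps
running in the margins. This file is pure lattice geometry: points `pt a b`, straight segments
`seg a v n` (as vertex lists), the four directions `Dir`, the tiling (`tileOf`, a partition of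
`ℤ²`), inner boxes and ports; the connectors, their cells and the arena of a tile are in the
companion file `SAWTileConnectors.lean`.

Nothing probabilistic is proved here; see `SupercriticalSAWPolygons` for `P_m`, `Z_m(x)`.

## Relation to `SupercriticalSAWSpaceFillingBoxes.lean`

`Literature/Barriers/CriticalPhenomena/SupercriticalSAWSpaceFillingBoxes.lean` sets up a
DIFFERENT geometry for the printed route to Theorem 6 (boxes `mBox (n+g) z` of even side on the
grid `(2(n+g)+2)ℤ²` with a symmetric moat `g`: `SupercriticalSAW.innerCorner/innerBox`,
`innerCardinalEdge`, `rungCells`, carrying the named facts `DKY2014_prop7_claim`,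
`DKY2014_prop7_disk`, `DKY2014_thm6_boundaryLayer`). The objects of this file live in the
sub-namespace `OddTile` (`OddTile.tile`, `OddTile.innerBox`, `OddTile.portA`, …) and serve a
direct proof of the box-free statement `SupercriticalSAW.DKY2014_thm6_disk` by an `ℓ¹`-sphere
attachment around the CENTRE of an odd tile (which is why the tiles here are odd and centred);
the two tilings never coincide and the named facts of the Boxes file are not discharged by this
development.
-/

noncomputable section

open Finset Literature.Probability.LatticeModels

namespace Literature.Probability.RandomPlanarGeometry.SAW

/-! ### Points of `ℤ²`, adjacency in coordinates -/

/-- The lattice point `(a, b) ∈ ℤ²`. [folklore] -/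
def pt (a b : ℤ) : Site 2 := ![a, b]

/-- First coordinate of `pt a b`. [folklore] -/
@[simp] theorem pt_apply_zero (a b : ℤ) : pt a b 0 = a := rfl

/-- Second coordinate of `pt a b`. [folklore] -/
@[simp] theorem pt_apply_one (a b : ℤ) : pt a b 1 = b := rfl

/-- Every site is `pt` of its coordinates. [folklore] -/
theorem pt_eta (w : Site 2) : pt (w 0) (w 1) = w := by
  funext i; fin_cases i <;> rfl

/-- The origin. [folklore] -/
@[simp] theorem pt_zero_zero : pt 0 0 = 0 := by
  funext i; fin_cases i <;> rfl

/-- Equality of sites in coordinates (the statement of `HexKernel.site_ext_iff` of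
`ParafermionicHalfCauchyRiemann.lean`, restated to keep the imports of this geometric file
light). [folklore] -/
theorem site_eq_iff (w w' : Site 2) : w = w' ↔ w 0 = w' 0 ∧ w 1 = w' 1 := by
  rw [funext_iff, Fin.forall_fin_two]

/-- Addition in coordinates. [folklore] -/
@[simp] theorem pt_add_pt (a b a' b' : ℤ) : pt a b + pt a' b' = pt (a + a') (b + b') := by
  funext i; fin_cases i <;> rfl

/-- Subtraction in coordinates. [folklore] -/
@[simp] theorem pt_sub_pt (a b a' b' : ℤ) : pt a b - pt a' b' = pt (a - a') (b - b') := by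
  funext i; fin_cases i <;> rfl

/-- Scalar multiples in coordinates. [folklore] -/
@[simp] theorem zsmul_pt (k a b : ℤ) : k • pt a b = pt (k * a) (k * b) := by
  funext i; fin_cases i <;> simp [pt]

/-- Negation in coordinates. [folklore] -/
@[simp] theorem neg_pt (a b : ℤ) : -pt a b = pt (-a) (-b) := by
  funext i; fin_cases i <;> rfl

/-- Adjacency in `ℤ²` in coordinates: the points agree in one coordinate and differ by `1` in
the other (the statement of `LatticeModels.zdGraph_two_adj_iff_coord` of `OnsagerYang.lean`,
restated with its five-line proof to avoid importing the Onsager–Yang development here).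
[folklore] -/
theorem adj_iff_coord (x y : Site 2) :
    (zdGraph 2).Adj x y ↔
      ((y 0 = x 0 + 1 ∨ x 0 = y 0 + 1) ∧ y 1 = x 1) ∨
        ((y 1 = x 1 + 1 ∨ x 1 = y 1 + 1) ∧ y 0 = x 0) := by
  rw [zdGraph_adj_iff, Fin.exists_fin_two]
  simp only [funext_iff, Fin.forall_fin_two, Pi.add_apply, Pi.single_eq_same,
    Pi.single_eq_of_ne (one_ne_zero : (1 : Fin 2) ≠ 0),
    Pi.single_eq_of_ne (zero_ne_one : (0 : Fin 2) ≠ 1), add_zero]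
  omega

/-- Adjacency of explicit points. [folklore] -/
theorem adj_pt_pt_iff (a b a' b' : ℤ) :
    (zdGraph 2).Adj (pt a b) (pt a' b') ↔
      ((a' = a + 1 ∨ a = a' + 1) ∧ b' = b) ∨ ((b' = b + 1 ∨ b = b' + 1) ∧ a' = a) := by
  rw [adj_iff_coord]; simp

/-- The `ℓ¹`-distance of two sites. [folklore] -/
def l1dist (w c : Site 2) : ℤ := |w 0 - c 0| + |w 1 - c 1|

/-- The `ℓ^∞`-distance of two sites. [folklore] -/
def linfdist (w c : Site 2) : ℤ := max |w 0 - c 0| |w 1 - c 1|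

/-- Adjacent sites are at `ℓ¹`-distance differing by at most one from any centre. [folklore] -/
theorem l1dist_le_of_adj {x y : Site 2} (h : (zdGraph 2).Adj x y) (c : Site 2) :
    l1dist y c ≤ l1dist x c + 1 ∧ l1dist x c ≤ l1dist y c + 1 := by
  simp only [l1dist, abs_eq_max_neg]
  rw [adj_iff_coord] at h
  omega

/-! ### Straight segments -/

/-- The straight segment of `n` steps from `a` in direction `v`, as the vertex list
`[a, a + v, …, a + n v]`. [folklore] -/
def seg (a v : Site 2) (n : ℕ) : List (Site 2) :=
  (List.range (n + 1)).map fun k : ℕ => a + (k : ℤ) • v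

/-- A segment of `n` steps has `n + 1` vertices. [folklore] -/
@[simp] theorem length_seg (a v : Site 2) (n : ℕ) : (seg a v n).length = n + 1 := by
  simp [seg]

/-- Segments are non-empty. [folklore] -/
theorem seg_ne_nil (a v : Site 2) (n : ℕ) : seg a v n ≠ [] := by
  rw [← List.length_pos_iff, length_seg]; omega

/-- Membership in a segment. [folklore] -/
theorem mem_seg_iff {a v : Site 2} {n : ℕ} {w : Site 2} :
    w ∈ seg a v n ↔ ∃ k : ℕ, k ≤ n ∧ w = a + (k : ℤ) • v := by
  simp only [seg, List.mem_map, List.mem_range]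
  constructor
  · rintro ⟨k, hk, rfl⟩; exact ⟨k, by omega, rfl⟩
  · rintro ⟨k, hk, rfl⟩; exact ⟨k, by omega, rfl⟩

/-- One more step: `seg a v (n+1) = seg a v n ++ [a + (n+1) v]`. [folklore] -/
theorem seg_succ (a v : Site 2) (n : ℕ) :
    seg a v (n + 1) = seg a v n ++ [a + ((n : ℤ) + 1) • v] := by
  simp [seg, List.range_succ]

/-- One more step, from the front: `seg a v (n+1) = a :: seg (a + v) v n`. [folklore] -/
theorem seg_succ' (a v : Site 2) (n : ℕ) : seg a v (n + 1) = a :: seg (a + v) v n := by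
  unfold seg
  rw [List.range_succ_eq_map, List.map_cons, List.map_map]
  simp only [Nat.cast_zero, zero_smul, add_zero, List.cons.injEq, true_and]
  refine List.map_congr_left fun k _ => ?_
  simp only [Function.comp_apply, Nat.cast_succ]
  module

/-- The first vertex of a segment. [folklore] -/
@[simp] theorem head?_seg (a v : Site 2) (n : ℕ) : (seg a v n).head? = some a := by
  cases n with
  | zero => simp [seg]
  | succ n => rw [seg_succ']; rfl

/-- The last vertex of a segment. [folklore] -/
@[simp] theorem getLast?_seg (a v : Site 2) (n : ℕ) :
    (seg a v n).getLast? = some (a + (n : ℤ) • v) := by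
  cases n with
  | zero => simp [seg]
  | succ n => rw [seg_succ, List.getLast?_append]; simp

/-- The first vertex of a segment. [folklore] -/
theorem head_seg (a v : Site 2) (n : ℕ) : (seg a v n).head (seg_ne_nil a v n) = a := by
  rw [← Option.some_inj, ← List.head?_eq_some_head, head?_seg]

/-- The last vertex of a segment. [folklore] -/
theorem getLast_seg (a v : Site 2) (n : ℕ) :
    (seg a v n).getLast (seg_ne_nil a v n) = a + (n : ℤ) • v := by
  rw [← Option.some_inj, ← List.getLast?_eq_some_getLast, getLast?_seg]

/-- A segment in a non-zero direction visits no vertex twice. [folklore] -/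
theorem nodup_seg (a : Site 2) {v : Site 2} (hv : v ≠ 0) (n : ℕ) : (seg a v n).Nodup := by
  refine List.Nodup.map_on (fun k hk k' hk' h => ?_) (List.nodup_range)
  have h' : ((k : ℤ) - k') • v = 0 := by rw [sub_smul]; exact sub_eq_zero.2 (add_left_cancel h)
  rcases smul_eq_zero.1 h' with h'' | h''
  · exact_mod_cast sub_eq_zero.1 h''
  · exact absurd h'' hv

/-- A segment whose direction is a lattice step is a chain of adjacent vertices. [folklore] -/
theorem isChain_seg (a : Site 2) {v : Site 2} (hv : (zdGraph 2).Adj 0 v) (n : ℕ) :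
    (seg a v n).IsChain (zdGraph 2).Adj := by
  induction n generalizing a with
  | zero => simp [seg]
  | succ n ih =>
    rw [seg_succ']
    refine List.IsChain.cons (ih (a + v)) fun y hy => ?_
    rw [head?_seg, Option.mem_def, Option.some_inj] at hy
    subst hy
    have := (zdGraph_adj_shift_iff a 0 v).2 hv
    simpa [add_comm] using this

/-- Reversing a segment: `[a + n v, …, a]` is the segment from `a + n v` in direction `-v`.
[folklore] -/
theorem reverse_seg (a v : Site 2) (n : ℕ) :
    (seg a v n).reverse = seg (a + (n : ℤ) • v) (-v) n := by
  induction n generalizing a with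
  | zero => simp [seg]
  | succ n ih =>
    rw [seg_succ', List.reverse_cons, ih, seg_succ]
    congr 1
    · congr 1; push_cast; module
    · simp only [List.cons.injEq, and_true]; push_cast; module

/-- Coordinates along a segment from `pt a b` in direction `pt p q`. [folklore] -/
theorem mem_seg_pt_iff {a b p q : ℤ} {n : ℕ} {w : Site 2} :
    w ∈ seg (pt a b) (pt p q) n ↔ ∃ k : ℕ, k ≤ n ∧ w 0 = a + k * p ∧ w 1 = b + k * q := by
  rw [mem_seg_iff]
  refine exists_congr fun k => and_congr_right fun _ => ?_
  rw [zsmul_pt, pt_add_pt, site_eq_iff, pt_apply_zero, pt_apply_one]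

/-! ### The four directions -/

/-- The four axis directions of `ℤ²`. [folklore] -/
inductive Dir
  | E | N | W | S
  deriving DecidableEq, Fintype

namespace Dir

/-- The unit vector of a direction. [folklore] -/
def vec : Dir → Site 2
  | E => pt 1 0
  | N => pt 0 1
  | W => pt (-1) 0
  | S => pt 0 (-1)

/-- The opposite direction. [folklore] -/
def neg : Dir → Dir
  | E => W
  | N => S
  | W => E
  | S => N

/-- `neg` is an involution. [folklore] -/
@[simp] theorem neg_neg (d : Dir) : d.neg.neg = d := by cases d <;> rfl

/-- The unit vector of the opposite direction. [folklore] -/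
@[simp] theorem vec_neg (d : Dir) : d.neg.vec = -d.vec := by
  cases d <;> simp [vec, neg]

/-- Direction vectors are lattice steps. [folklore] -/
theorem adj_zero_vec (d : Dir) : (zdGraph 2).Adj 0 d.vec := by
  rw [show (0 : Site 2) = pt 0 0 from (pt_eta 0).symm]
  cases d <;> simp only [vec] <;> rw [adj_pt_pt_iff] <;> omega

/-- Direction vectors are non-zero. [folklore] -/
theorem vec_ne_zero (d : Dir) : d.vec ≠ 0 :=
  (adj_zero_vec d).ne.symm

end Dir

/-! ### The tiling -/

namespace OddTile

variable (m r : ℕ)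

/-- Half-width `h = m + r + 1` of a tile. [cite: DuminilCopinKozmaYadin2014, §3 (m-boxes)] -/
def hw : ℕ := m + r + 1

/-- Side `L = 2h + 1` of a tile (odd, so that tiles have lattice centres). [cite: DuminilCopinKozmaYadin2014, §3 (m-boxes)] -/
def side : ℕ := 2 * hw m r + 1

/-- The centre `L τ` of tile `τ`. [cite: DuminilCopinKozmaYadin2014, §3 (m-boxes)] -/
def ctr (τ : Site 2) : Site 2 := (side m r : ℤ) • τ

/-- The tile `τ`: the `ℓ^∞`-ball of radius `h` about `L τ` (the DKY box of side `2m+1`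
together with a margin of width `r` resp. `r+1`). [cite: DuminilCopinKozmaYadin2014, §3 (m-boxes)] -/
def tile (τ : Site 2) : Finset (Site 2) :=
  Fintype.piFinset fun i => Icc (ctr m r τ i - hw m r) (ctr m r τ i + hw m r)

variable {m r}

/-- Coordinates of the centre. [folklore] -/
@[simp] theorem ctr_apply (τ : Site 2) (i : Fin 2) : ctr m r τ i = (side m r : ℤ) * τ i := by
  simp [ctr]

/-- The side in terms of the half-width, over `ℤ`. [folklore] -/
theorem side_eq : (side m r : ℤ) = 2 * hw m r + 1 := by simp [side]

/-- The half-width in terms of `m, r`, over `ℤ`. [folklore] -/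
theorem hw_eq : (hw m r : ℤ) = m + r + 1 := by simp [hw]

/-- The side is positive. [folklore] -/
theorem side_pos : (0 : ℤ) < side m r := by rw [side_eq]; positivity

/-- Centres of tiles with a smaller index are smaller by at least one side length. [folklore] -/
theorem side_mul_le {a b : ℤ} (hab : a < b) : (side m r : ℤ) * a + side m r ≤ side m r * b := by
  have h1 : a + 1 ≤ b := hab
  calc (side m r : ℤ) * a + side m r = side m r * (a + 1) := by ring
    _ ≤ side m r * b := mul_le_mul_of_nonneg_left h1 side_pos.le

/-- Membership in a tile: every coordinate within `h` of the centre. [cite: DuminilCopinKozmaYadin2014, §3 (m-boxes)] -/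
theorem mem_tile_iff {τ w : Site 2} :
    w ∈ tile m r τ ↔ ∀ i, (side m r : ℤ) * τ i - hw m r ≤ w i ∧ w i ≤ (side m r : ℤ) * τ i + hw m r := by
  simp [tile, Fintype.mem_piFinset]

variable (m r) in
/-- The index of the tile containing the integer `z` (in one coordinate). [folklore] -/
def tileIdx (z : ℤ) : ℤ := (z + hw m r) / (side m r : ℤ)

/-- The tile of index `tileIdx z` contains `z`. [folklore] -/
theorem tileIdx_spec (z : ℤ) :
    (side m r : ℤ) * tileIdx m r z - hw m r ≤ z ∧ z ≤ (side m r : ℤ) * tileIdx m r z + hw m r := by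
  have hL : (0 : ℤ) < side m r := by rw [side_eq]; positivity
  have h1 := Int.emod_add_mul_ediv (z + hw m r) (side m r)
  have h2 := Int.emod_nonneg (z + hw m r) hL.ne'
  have h3 := Int.emod_lt_of_pos (z + hw m r) hL
  unfold tileIdx
  set q := (z + ↑(hw m r)) / ↑(side m r)
  set ρ := (z + ↑(hw m r)) % ↑(side m r)
  rw [side_eq] at h1 h3 ⊢
  constructor <;> nlinarith

/-- Uniqueness of the tile index. [folklore] -/
theorem tileIdx_eq {z k : ℤ} (h : (side m r : ℤ) * k - hw m r ≤ z ∧ z ≤ (side m r : ℤ) * k + hw m r) :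
    tileIdx m r z = k := by
  have hs := tileIdx_spec (m := m) (r := r) z
  rw [side_eq] at h hs
  set j := tileIdx m r z
  rcases lt_trichotomy j k with hjk | hjk | hjk
  · nlinarith
  · exact hjk
  · nlinarith

variable (m r) in
/-- The tile containing a site. [folklore] -/
def tileOf (w : Site 2) : Site 2 := fun i => tileIdx m r (w i)

/-- Every site lies in its tile. [folklore] -/
theorem mem_tile_tileOf (w : Site 2) : w ∈ tile m r (tileOf m r w) :=
  mem_tile_iff.2 fun i => tileIdx_spec (w i)

/-- A site lies in tile `τ` iff `τ` is its tile (the tiles partition `ℤ²`). [folklore] -/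
theorem mem_tile_iff_tileOf_eq {τ w : Site 2} : w ∈ tile m r τ ↔ tileOf m r w = τ := by
  constructor
  · intro h
    funext i
    exact tileIdx_eq (mem_tile_iff.1 h i)
  · rintro rfl; exact mem_tile_tileOf w

/-- The centre of a tile belongs to it. [folklore] -/
theorem ctr_mem_tile (τ : Site 2) : ctr m r τ ∈ tile m r τ :=
  mem_tile_iff.2 fun i => by simp

/-- The tile of a centre. [folklore] -/
@[simp] theorem tileOf_ctr (τ : Site 2) : tileOf m r (ctr m r τ) = τ :=
  mem_tile_iff_tileOf_eq.1 (ctr_mem_tile τ)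

/-- Distinct tiles are disjoint. [folklore] -/
theorem tile_disjoint {τ τ' : Site 2} (h : τ ≠ τ') : Disjoint (tile m r τ) (tile m r τ') :=
  disjoint_left.2 fun _ hw hw' =>
    h ((mem_tile_iff_tileOf_eq.1 hw).symm.trans (mem_tile_iff_tileOf_eq.1 hw'))

/-- A site of tile `τ` is within `ℓ^∞`-distance `h` of the centre. [folklore] -/
theorem linfdist_ctr_le_of_mem_tile {τ w : Site 2} (h : w ∈ tile m r τ) :
    linfdist w (ctr m r τ) ≤ hw m r := by
  rw [mem_tile_iff] at h
  have h0 := h 0; have h1 := h 1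
  simp only [linfdist, ctr_apply, abs_eq_max_neg]
  omega

/-- A site of tile `τ` is within `ℓ¹`-distance `2h` of the centre. [folklore] -/
theorem l1dist_ctr_le_of_mem_tile {τ w : Site 2} (h : w ∈ tile m r τ) :
    l1dist w (ctr m r τ) ≤ 2 * hw m r := by
  rw [mem_tile_iff] at h
  have h0 := h 0; have h1 := h 1
  simp only [l1dist, ctr_apply, abs_eq_max_neg]
  omega

/-! ### Inner boxes and their cardinal edges (ports) -/

variable (m r) in
/-- The lower-left corner `L τ - (m+1, m+1)` of the inner box of tile `τ`. [cite: DuminilCopinKozmaYadin2014, §3 (m-boxes)] -/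
def innerCorner (τ : Site 2) : Site 2 := ctr m r τ - pt (m + 1) (m + 1)

variable (m r) in
/-- The inner box of tile `τ`: the translate of `[0, 2m+1]²` (`squareBox m`, the box carrying a
polygon of `P_m`) with lower-left corner `innerCorner τ`; it leaves margins of width `r` (west,
south) and `r + 1` (east, north) inside the tile. [cite: DuminilCopinKozmaYadin2014, §3 (m-boxes)] -/
def innerBox (τ : Site 2) : Finset (Site 2) :=
  (squareBox m).map (addRightEmbedding (innerCorner m r τ))

/-- Coordinates of the inner corner. [folklore] -/
@[simp] theorem innerCorner_apply_zero (τ : Site 2) :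
    innerCorner m r τ 0 = (side m r : ℤ) * τ 0 - (m + 1) := by
  simp [innerCorner, pt]

/-- Coordinates of the inner corner. [folklore] -/
@[simp] theorem innerCorner_apply_one (τ : Site 2) :
    innerCorner m r τ 1 = (side m r : ℤ) * τ 1 - (m + 1) := by
  simp [innerCorner, pt]

/-- Membership in the inner box: coordinates in `[L τᵢ - m - 1, L τᵢ + m]`.
[cite: DuminilCopinKozmaYadin2014, §3 (m-boxes)] -/
theorem mem_innerBox_iff {τ v : Site 2} :
    v ∈ innerBox m r τ ↔
      ∀ i, (side m r : ℤ) * τ i - (m + 1) ≤ v i ∧ v i ≤ (side m r : ℤ) * τ i + m := by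
  rw [Fin.forall_fin_two]
  simp only [innerBox, mem_map, addRightEmbedding_apply, mem_squareBox_iff, Fin.forall_fin_two]
  constructor
  · rintro ⟨w, ⟨hw0, hw1⟩, rfl⟩
    simp only [Pi.add_apply, innerCorner_apply_zero, innerCorner_apply_one]
    omega
  · rintro ⟨h0, h1⟩
    refine ⟨v - innerCorner m r τ, ?_, by simp⟩
    simp only [Pi.sub_apply, innerCorner_apply_zero, innerCorner_apply_one]
    omega

/-- The inner box lies inside the tile, at `ℓ^∞`-distance `≤ h - r` from the centre (margins).
[cite: DuminilCopinKozmaYadin2014, §3 (m-boxes)] -/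
theorem mem_innerBox_bounds {τ v : Site 2} (h : v ∈ innerBox m r τ) (i : Fin 2) :
    (side m r : ℤ) * τ i - hw m r + r ≤ v i ∧ v i ≤ (side m r : ℤ) * τ i + hw m r - r - 1 := by
  have := mem_innerBox_iff.1 h i
  rw [hw_eq]; omega

/-- The inner box is contained in the tile. [cite: DuminilCopinKozmaYadin2014, §3 (m-boxes)] -/
theorem innerBox_subset_tile (τ : Site 2) : innerBox m r τ ⊆ tile m r τ := fun v hv =>
  mem_tile_iff.2 fun i => by have := mem_innerBox_bounds hv i; omega

variable (m r) in
/-- First endpoint of the cardinal edge (port) of the inner box of `τ` facing direction `d`: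
the translate of `(2m+1, m)` (east), `(m, 2m+1)` … of `cardinalEdges m`; it has offset `-1`
along the side. [cite: DuminilCopinKozmaYadin2014, §2 (cardinal edges) and §3] -/
def portA (τ : Site 2) : Dir → Site 2
  | .E => pt ((side m r : ℤ) * τ 0 + m) ((side m r : ℤ) * τ 1 - 1)
  | .N => pt ((side m r : ℤ) * τ 0 - 1) ((side m r : ℤ) * τ 1 + m)
  | .W => pt ((side m r : ℤ) * τ 0 - (m + 1)) ((side m r : ℤ) * τ 1 - 1)
  | .S => pt ((side m r : ℤ) * τ 0 - 1) ((side m r : ℤ) * τ 1 - (m + 1))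

variable (m r) in
/-- Second endpoint of the cardinal edge (port) of the inner box of `τ` facing direction `d`
(offset `0` along the side). [cite: DuminilCopinKozmaYadin2014, §2 (cardinal edges) and §3] -/
def portB (τ : Site 2) : Dir → Site 2
  | .E => pt ((side m r : ℤ) * τ 0 + m) ((side m r : ℤ) * τ 1)
  | .N => pt ((side m r : ℤ) * τ 0) ((side m r : ℤ) * τ 1 + m)
  | .W => pt ((side m r : ℤ) * τ 0 - (m + 1)) ((side m r : ℤ) * τ 1)
  | .S => pt ((side m r : ℤ) * τ 0) ((side m r : ℤ) * τ 1 - (m + 1))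

/-- The two endpoints of a port are adjacent. [folklore] -/
theorem adj_portA_portB (τ : Site 2) (d : Dir) :
    (zdGraph 2).Adj (portA m r τ d) (portB m r τ d) := by
  cases d <;> simp only [portA, portB] <;> rw [adj_pt_pt_iff] <;> omega

/-- Ports lie in the inner box. [cite: DuminilCopinKozmaYadin2014, §2 (cardinal edges)] -/
theorem portA_mem_innerBox (τ : Site 2) (d : Dir) : portA m r τ d ∈ innerBox m r τ := by
  rw [mem_innerBox_iff, Fin.forall_fin_two]
  cases d <;> simp [portA] <;> omega

/-- Ports lie in the inner box. [cite: DuminilCopinKozmaYadin2014, §2 (cardinal edges)] -/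
theorem portB_mem_innerBox (τ : Site 2) (d : Dir) : portB m r τ d ∈ innerBox m r τ := by
  rw [mem_innerBox_iff, Fin.forall_fin_two]
  cases d <;> simp [portB] <;> omega

/-- The port endpoints are distinct. [folklore] -/
theorem portA_ne_portB (τ : Site 2) (d : Dir) : portA m r τ d ≠ portB m r τ d :=
  (adj_portA_portB τ d).ne

/-- The site just outside the port (one step in direction `d` from `portA`) lies in the margin
of the tile: in the tile but not in the inner box (needs `r ≥ 1` on the west/south sides).
[cite: DuminilCopinKozmaYadin2014, §3] -/
theorem portA_add_vec_mem_tile (hr : 1 ≤ r) (τ : Site 2) (d : Dir) :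
    portA m r τ d + d.vec ∈ tile m r τ ∧ portA m r τ d + d.vec ∉ innerBox m r τ := by
  rw [mem_tile_iff, mem_innerBox_iff, Fin.forall_fin_two, Fin.forall_fin_two, hw_eq]
  cases d <;> simp [portA, Dir.vec] <;> omega

/-- Same for `portB`. [cite: DuminilCopinKozmaYadin2014, §3] -/
theorem portB_add_vec_mem_tile (hr : 1 ≤ r) (τ : Site 2) (d : Dir) :
    portB m r τ d + d.vec ∈ tile m r τ ∧ portB m r τ d + d.vec ∉ innerBox m r τ := by
  rw [mem_tile_iff, mem_innerBox_iff, Fin.forall_fin_two, Fin.forall_fin_two, hw_eq]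
  cases d <;> simp [portB, Dir.vec] <;> omega

end OddTile

end Literature.Probability.RandomPlanarGeometry.SAW
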